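import Summits.BirchSwinnertonDyer.BirchSwinnertonDyer.Theses.TameQuarticManinParity
import Summits.BirchSwinnertonDyer.BirchSwinnertonDyer.Theorems.TeichmullerTwistDescentTwistedPeriodLatticeIndexFrame
import Literature.NumberTheory.EllipticCurves.AlgebraicModularParametrizationWithShift
import HarnessLib

/-!
# Route `TameQuarticManinParity`, LINE 28 (bsd-idea-3 g8), G28 `TprimeIrrOrientationOfPeriodSaturation`
# (stmt-BirchSwinnertonDyer-23285) — period saturation of the twist partner ⇒ the orientation inclusion
# `Λ(f) ⊆ g(χ₋₃)·Λ(f ⊗ χ₋₃)`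

Seat `bsd-line-tqmp-g28-p1` (prover) on the planner-of-record's (bsd-idea-3 g8) glue item G28, critic idea-crit-5
VERDICT #158 PASS-WITH-PRICE. THEOREMS ONLY (no definition, no named fact, no `sorry`; axioms `propext`,
`Classical.choice`, `Quot.sound`). BSD is NOT proved by this; O22 (stmt-28139) / B23 (stmt-28282) are NOT advanced by
this file alone (O22 ⇒ G28 is a one-liner; the reduction O22 ⟸ PS ∧ G28 waits on the period-saturation half `PS_of`).

## Content

For `9 ∣ N`, the shift `t = [1, 1/3; 0, 1]` (`shiftCuspForm` / `shiftOp`, transpose `shiftDual = t_*` on `S₂(Γ₀(N))^∨`,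
tree `AlgebraicModularParametrizationWithShift`) and the primitive quadratic character `χ = χ₋₃` mod `3`
(twist `charTwist`, tree `CuspFormTwist`), with `g = g(χ)` the Gauss sum:

* `dirichletCharacter_three_apply_two` — `χ(2) = −1`;
* `gaussSum_smul_charTwist_eq_shift_sub` — **`g · (h ⊗ χ) = h∣t − h∣t∣t`** for every `h ∈ S₂(Γ₀(N))` (pointwise
  from `coe_charTwist`: `g(χ⁻¹)·(h ⊗ χ) = ∑_u χ⁻¹(u) h∣[1, u/3; 0, 1]`, `χ(0) = 0`, `χ(1) = 1`, `χ(2) = −1`);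
* `charTwist_add_shift_add_shift_shift_eq_zero` — **`3`-depletion of the twist**, `(h ⊗ χ) + (h ⊗ χ)∣t + (h ⊗ χ)∣t∣t = 0`
  (apply `t`, `t²` to the previous identity and add; `t³ = 1`, `g ≠ 0`) — no `q`-expansion of the shift is needed;
* `mem_gaussSum_mul_periodLattice_charTwist_of_periodSaturation` — **the G28 algebra** for any `f ∈ S₂(Γ₀(N))` with
  `aₙ(f) = 0` for `3 ∣ n` and `F = f ⊗ χ`: if every value `((t_* − 1)φ)(F)`, `φ ∈ H₁ = periodHomology N`, is a value
  `((t_* − 1)²ψ)(F)`, `ψ ∈ H₁` (period saturation of `F`), then `Λ(f) ⊆ g·Λ(F)`. Proof (memo LINE23 §13.10 (a)–(c) of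
  the ideator, made duality-free): `g·φ(f) = φ(F∣t − F∣t²) = −((t_* − 1)t_*φ)(F)` by the twist involution
  `(f ⊗ χ) ⊗ χ = f` (`charTwist_charTwist_eq_self_of_cuspCoeff_eq_zero`); period saturation at `t_*φ` and the
  `3`-depletion give `= 3·(t_*ψ)(F)`; finally `g² = χ(−1)·3` (`gaussSum_stdAddChar_sq`) yields
  `φ(f) = g·(χ(−1)(t_*ψ)(F))`, a `g`-multiple of a period of `F` (`t_*` preserves `H₁`, `shiftDual_mem_periodHomology`).

The by-name theorem `tprimeIrrOrientationOfPeriodSaturation_proof : TprimeIrrOrientationOfPeriodSaturation` is the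
specialisation `f = D.f` (newform of level `N = N_W`, `9 ∣ N`, so `aₙ = 0` for `3 ∣ n`:
`cuspCoeff_eq_zero_of_isNewform0_of_sq_dvd_of_dvd`); it is appended once the gate has rendered the decl into the route file.
-/

set_option autoImplicit false
-- D-0017: single-problem summit, so `Summit.BirchSwinnertonDyer.BirchSwinnertonDyer.…` repeats a namespace BY DESIGN.
set_option linter.dupNamespace false

noncomputable section

open scoped MatrixGroups ModularForm

open CongruenceSubgroup

namespace Summit.BirchSwinnertonDyer.BirchSwinnertonDyer.Theorems.TameQuarticManinParity

open Literature.NumberTheory.EllipticCurves Literature.NumberTheory.EllipticCurves.ModularForms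
  Summit.BirchSwinnertonDyer.BirchSwinnertonDyer.Theses.TameQuarticManinParity
  Summit.BirchSwinnertonDyer.BirchSwinnertonDyer.Theorems.TeichmullerTwistDescent.TwistedPeriodLatticeIndexFrame

section Identities

variable {N : ℕ} [NeZero N] (h9 : 3 ^ 2 ∣ N) {χ : DirichletCharacter ℂ 3}

/-- A primitive quadratic Dirichlet character mod `3` is the Legendre symbol: `χ(2) = -1`. [folklore] -/
theorem dirichletCharacter_three_apply_two (hχ : χ.IsQuadratic) (hprim : χ.IsPrimitive) :
    χ (2 : ZMod 3) = -1 := by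
  have hu : IsUnit (2 : ZMod 3) := by decide
  rcases sq_eq_one_iff.mp (apply_sq_eq_one_of_isQuadratic hχ hu) with h | h
  · exfalso
    refine ne_one_of_isPrimitive hprim (by norm_num) (MulChar.ext fun a ↦ ?_)
    rw [MulChar.one_apply_coe]
    have ha : (a : ZMod 3) = 1 ∨ (a : ZMod 3) = 2 := by
      have h0 : (a : ZMod 3) ≠ 0 := a.ne_zero
      revert h0
      generalize (a : ZMod 3) = x
      decide +revert
    rcases ha with ha | ha
    · rw [ha, map_one]
    · rw [ha, h]
  · exact h

/-- **The twist by `χ₋₃` through the shift**: `g(χ) · (h ⊗ χ) = h ∣ t − (h ∣ t) ∣ t` for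
`t = [1, 1/3; 0, 1]`, `9 ∣ N` (`coe_charTwist`: `g(χ⁻¹) h_χ = ∑_u χ⁻¹(u) h ∣ [1, u/3; 0, 1]`, with
`χ(0) = 0`, `χ(1) = 1`, `χ(2) = -1`, `χ⁻¹ = χ`). [cite: Shimura1971, Prop. 3.64] -/
theorem gaussSum_smul_charTwist_eq_shift_sub (hχ : χ.IsQuadratic) (hprim : χ.IsPrimitive)
    (h : CuspForm (Gamma0 N) 2) :
    gaussSum χ (ZMod.stdAddChar (N := 3)) • charTwist N (dvd_refl N) h9 hχ h =
      shiftCuspForm N h9 h - shiftCuspForm N h9 (shiftCuspForm N h9 h) := by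
  have hg : gaussSum χ (ZMod.stdAddChar (N := 3)) ≠ 0 :=
    gaussSum_stdAddChar_ne_zero_of_isPrimitive hprim
  have h2 : χ (2 : ZMod 3) = -1 := dirichletCharacter_three_apply_two hχ hprim
  haveI : Fact (1 < 3) := ⟨by norm_num⟩
  have hs : ∀ G : ZMod 3 → ℂ, ∑ x : ZMod 3, G x = G 0 + G 1 + G 2 := fun G ↦ Fin.sum_univ_three G
  apply DFunLike.ext
  intro τ
  rw [CuspForm.IsGLPos.smul_apply, CuspForm.sub_apply, shiftCuspForm_apply, shiftCuspForm_apply,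
    shiftCuspForm_apply, vadd_vadd,
    show (charTwist N (dvd_refl N) h9 hχ h) τ = (⇑(charTwist N (dvd_refl N) h9 hχ h) : UpperHalfPlane → ℂ) τ from rfl,
    coe_charTwist, Pi.smul_apply, coe_twistRaw, Finset.sum_apply]
  simp only [Pi.smul_apply, slash_twistT_apply, smul_eq_mul, ratCast_twistShift]
  rw [hχ.inv, mul_inv_cancel_left₀ hg, hs, ZMod.val_zero, ZMod.val_one, ZMod.val_two_eq_two_mod,
    MulChar.map_zero, map_one, h2]
  norm_num
  ring

/-- **`3`-depletion of the twist**: `(h ⊗ χ) + (h ⊗ χ) ∣ t + (h ⊗ χ) ∣ t ∣ t = 0` (apply `t`, `t²` to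
`g · (h ⊗ χ) = h ∣ t − h ∣ t²` and add, using `t³ = 1` and `g ≠ 0`). [cite: Shimura1971, Prop. 3.64] -/
theorem charTwist_add_shift_add_shift_shift_eq_zero (hχ : χ.IsQuadratic) (hprim : χ.IsPrimitive)
    (h : CuspForm (Gamma0 N) 2) :
    charTwist N (dvd_refl N) h9 hχ h + shiftCuspForm N h9 (charTwist N (dvd_refl N) h9 hχ h) +
      shiftCuspForm N h9 (shiftCuspForm N h9 (charTwist N (dvd_refl N) h9 hχ h)) = 0 := by
  have hg : gaussSum χ (ZMod.stdAddChar (N := 3)) ≠ 0 :=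
    gaussSum_stdAddChar_ne_zero_of_isPrimitive hprim
  set g := gaussSum χ (ZMod.stdAddChar (N := 3)) with hgdef
  set F := charTwist N (dvd_refl N) h9 hχ h with hF
  have e0 : g • F = shiftOp N h9 h - shiftOp N h9 (shiftOp N h9 h) :=
    gaussSum_smul_charTwist_eq_shift_sub h9 hχ hprim h
  have e1 : g • shiftOp N h9 F = shiftOp N h9 (shiftOp N h9 h) - h := by
    rw [← map_smul, e0, map_sub, shiftOp_shiftOp_shiftOp]
  have e2 : g • shiftOp N h9 (shiftOp N h9 F) = h - shiftOp N h9 h := by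
    rw [← map_smul, e1, map_sub, shiftOp_shiftOp_shiftOp]
  have hsum : g • (F + shiftOp N h9 F + shiftOp N h9 (shiftOp N h9 F)) = 0 := by
    rw [smul_add, smul_add, e0, e1, e2]
    abel
  simpa only [shiftOp_apply] using (smul_eq_zero.mp hsum).resolve_left hg

/-- **Period saturation ⇒ orientation** (the algebra of memo §13.10 (a)–(c)), for any `f ∈ S₂(Γ₀(N))`,
`9 ∣ N`, with `aₙ(f) = 0` whenever `3 ∣ n`, and `F := f ⊗ χ`, `χ = χ₋₃`: if every value
`((t_* − 1)φ)(F)`, `φ ∈ H₁`, is a value `((t_* − 1)²ψ)(F)`, `ψ ∈ H₁`, then `Λ(f) ⊆ g(χ)·Λ(F)`.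
Proof: `g·φ(f) = φ(F∣t − F∣t²) = −((t_*−1)t_*φ)(F) = −((t_*−1)²ψ)(F) = 3(t_*ψ)(F)` (twist involution
`(f ⊗ χ) ⊗ χ = f`, `3`-depletion `F + F∣t + F∣t² = 0`), and `g² = χ(−1)·3`. [cite: Stevens1989, Lemma (5.4)] -/
theorem mem_gaussSum_mul_periodLattice_charTwist_of_periodSaturation (hχ : χ.IsQuadratic)
    (hprim : χ.IsPrimitive) (f : CuspForm (Gamma0 N) 2) (h0 : ∀ n : ℕ, 3 ∣ n → cuspCoeff f n = 0)
    (hPS : ∀ φ ∈ periodHomology N, ∃ ψ ∈ periodHomology N,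
      (shiftDual N h9 φ - φ) (charTwist N (dvd_refl N) h9 hχ f) =
        (shiftDual N h9 (shiftDual N h9 ψ) - 2 • shiftDual N h9 ψ + ψ) (charTwist N (dvd_refl N) h9 hχ f))
    {z : ℂ} (hz : z ∈ periodLattice f) :
    ∃ w ∈ periodLattice (charTwist N (dvd_refl N) h9 hχ f), z = gaussSum χ (ZMod.stdAddChar (N := 3)) * w := by
  haveI : Fact (Nat.Prime 3) := ⟨Nat.prime_three⟩
  set g := gaussSum χ (ZMod.stdAddChar (N := 3)) with hgdef
  set F := charTwist N (dvd_refl N) h9 hχ f with hF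
  -- `z = φ(f)` for a cycle `φ ∈ H₁`
  rw [periodLattice_eq_map_periodHomology, AddSubgroup.mem_map] at hz
  obtain ⟨φ, hφ, rfl⟩ := hz
  change ∃ w ∈ periodLattice F, φ f = g * w
  -- period saturation at the cycle `t_* φ`
  obtain ⟨ψ, hψ, hPSφ⟩ := hPS (shiftDual N h9 φ) (shiftDual_mem_periodHomology N h9 hφ)
  simp only [LinearMap.sub_apply, LinearMap.add_apply, LinearMap.smul_apply, shiftDual_apply,
    nsmul_eq_mul, Nat.cast_ofNat] at hPSφ
  -- `(f ⊗ χ) ⊗ χ = f`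
  have h0' : ∀ n : ℕ, ¬ IsUnit ((n : ℕ) : ZMod 3) → cuspCoeff f n = 0 := by
    intro n hn
    refine h0 n ?_
    by_contra hpn
    exact hn ((ZMod.isUnit_iff_coprime n 3).mpr
      (Nat.coprime_comm.mp (Nat.prime_three.coprime_iff_not_dvd.mpr hpn)))
  have hFf : charTwist N (dvd_refl N) h9 hχ F = f :=
    charTwist_charTwist_eq_self_of_cuspCoeff_eq_zero h9 hχ hprim f h0'
  -- `g·f = F∣t − F∣t²`, evaluated at `φ`
  have hgf := gaussSum_smul_charTwist_eq_shift_sub h9 hχ hprim F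
  rw [hFf] at hgf
  have h1 := congrArg φ hgf
  rw [map_smul, map_sub, smul_eq_mul] at h1
  -- `3`-depletion of `F`, evaluated at `ψ`
  have h2 := congrArg ψ (charTwist_add_shift_add_shift_shift_eq_zero h9 hχ hprim f)
  rw [map_add, map_add, map_zero] at h2
  -- `g·φ(f) = 3·ψ(F∣t)`
  have h3 : g * φ f = 3 * ψ (shiftCuspForm N h9 F) := by
    linear_combination h1 - hPSφ - h2
  -- `g² = χ(−1)·3`
  have hsq : g ^ 2 = χ (-1) * (3 : ℂ) := by
    have := gaussSum_stdAddChar_sq hχ hprim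
    simpa using this
  have hχ1 : χ (-1) ^ 2 = 1 := apply_sq_eq_one_of_isQuadratic hχ isUnit_one.neg
  have hmem : ψ (shiftCuspForm N h9 F) ∈ periodLattice F := by
    rw [periodLattice_eq_map_periodHomology, AddSubgroup.mem_map]
    exact ⟨shiftDual N h9 ψ, shiftDual_mem_periodHomology N h9 hψ, rfl⟩
  refine ⟨χ (-1) * ψ (shiftCuspForm N h9 F), quadratic_apply_mul_mem hχ (-1) hmem, ?_⟩
  linear_combination (-(φ f)) * hχ1 + (χ (-1) * g / 3) * h3 - (χ (-1) * φ f / 3) * hsq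

end Identities

section ByName

/-- **G28 `TprimeIrrOrientationOfPeriodSaturation`** (stmt-BirchSwinnertonDyer-23285), BY NAME: for a Kodaira-III curve
`W` in the tame quartic class with irreducible `ρ̄_{W,3}` (binders displayed, not used), a conductor-level datum `D`,
`9 ∣ N_W`, and `χ = χ₋₃`: period saturation of `F = D.f ⊗ χ` on `H₁(X₀(N), ℤ)` implies `Λ(D.f) ⊆ g(χ)·Λ(F)` — O22's
conclusion verbatim. Specialisation of `mem_gaussSum_mul_periodLattice_charTwist_of_periodSaturation` to the newform
`D.f` (`aₙ(D.f) = 0` for `3 ∣ n` since `9 ∣ N_W`, Atkin–Lehner). Glue only: weaker than O22 (stmt-28139); BSD is not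
proved by this. [cite: Stevens1989, Lemma (5.4)] [cite: AtkinLehner1970, Thm. 3] -/
theorem tprimeIrrOrientationOfPeriodSaturation_proof : TprimeIrrOrientationOfPeriodSaturation := by
  unfold TprimeIrrOrientationOfPeriodSaturation
  intro W _ _ _ _ _ _ _ _ D h9 χ hχ hprim hPS z hz
  exact mem_gaussSum_mul_periodLattice_charTwist_of_periodSaturation h9 hχ hprim D.f
    (fun _ hn ↦ cuspCoeff_eq_zero_of_isNewform0_of_sq_dvd_of_dvd D.isNewformOf.1 Nat.prime_three h9 hn) hPS hz

end ByName

end Summit.BirchSwinnertonDyer.BirchSwinnertonDyer.Theorems.TameQuarticManinParity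

end
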